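import Mathlib
import Literature.Analysis.FluidPDE.LandauSolutions
import Summits.NavierStokesRegularity.NavierStokesRegularity.Theorems.LandauTailLandauTailBlowupLandau
import Summits.NavierStokesRegularity.NavierStokesRegularity.Theorems.LandauTailLandauTailBlowupLandauFlux
import Summits.NavierStokesRegularity.NavierStokesRegularity.Theorems.LandauTailLandauTailBlowupFluxIdentity
import Summits.NavierStokesRegularity.NavierStokesRegularity.Theorems.LandauTailLandauTailBlowupFluxIntegral

/-!
# Landau's point force (stubs `landauTail_landau_flux_parallel`, `landauTail_landau_point_force`)

Support theorems for the line `registered` of the crux `LandauTail.LandauTailBlowup`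
(stmt-NavierStokesRegularity-1944). For the explicit Landau solution `U = landauAxisField a A`,
`P = landauAxisPressure a A` (unit axis `a`, parameter `A > 1`, viscosity `1`) and the radial
cutoff `Ψ₁(y) = smoothTransition (‖y‖² - 1)`, the momentum-flux vector
`B = ∫ (⟪U, ∇Ψ₁⟫ U + P ∇Ψ₁ + (ΔΨ₁) U)` satisfies:

* `landauTail_landau_flux_parallel`: `B = (2π ∫_{-1}^{1} F_A) • a`. Proof: every linear
  isometry `S` fixing `a` maps the integrand covariantly (`U (S z) = S (U z)`, `P (S z) = P z`,
  the cutoff is radial), so `S B = B` (change of variables + linearity of the Bochner integral);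
  reflecting across the plane `w^⊥` for `w ⊥ a` gives `⟪w, B⟫ = 0`, hence `B = ⟪a, B⟫ a`, and
  `⟪a, B⟫ = 2π ∫ F_A` is `landauTail_landau_flux_eq`.
* `landauTail_landau_point_force`: Landau's point force in solenoidal-tested form,
  `∫ ⟪U, (U·∇)φ⟫ + ⟪U, Δφ⟫ = -β(A) ⟪a, φ 0⟫`,
  `β(A) = 2π [(8A/3)(3A² + 1)/(A² - 1) - 4A² log ((A + 1)/(A - 1))]`
  (Landau 1944; Batchelor 1967, §4.6; Šverák, arXiv:math/0604550, §2 (2.3);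
  Lemarié-Rieusset 2016, (10.48)): the abstract flux identity `landauTail_flux_identity` applied
  to the Landau solution (`landauTail_landauAxisField_profile`), the first theorem, and the
  closed form `landauTail_landau_flux_integral`.
-/

set_option linter.dupNamespace false

namespace Summit.NavierStokesRegularity.NavierStokesRegularity.Theorems

open MeasureTheory InnerProductSpace Literature.Analysis.FluidPDE
open scoped RealInnerProductSpace Laplacian

/-! ### Vectors fixed by every isometry fixing the axis -/

/-- If every linear isometry fixing `a` fixes `B`, then `B ⊥ w` for every `w ⊥ a`: reflect across
the hyperplane `w^⊥` (which contains `a`), `⟪w, B⟫ = ⟪-w, B⟫`. [folklore] -/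
theorem landauTail_inner_eq_zero_of_map_eq {a B : EuclideanSpace ℝ (Fin 3)}
    (h : ∀ S : EuclideanSpace ℝ (Fin 3) ≃ₗᵢ[ℝ] EuclideanSpace ℝ (Fin 3), S a = a → S B = B)
    {w : EuclideanSpace ℝ (Fin 3)} (hwa : ⟪w, a⟫ = 0) : ⟪w, B⟫ = 0 := by
  have hSa : (ℝ ∙ w)ᗮ.reflection a = a :=
    Submodule.reflection_mem_subspace_eq_self
      (Submodule.mem_orthogonal_singleton_iff_inner_right.2 hwa)
  have key := ((ℝ ∙ w)ᗮ.reflection).inner_map_map w B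
  rw [h _ hSa, Submodule.reflection_orthogonalComplement_singleton_eq_neg, inner_neg_left] at key
  linarith

/-- If every linear isometry fixing the unit vector `a` fixes `B`, then `B = ⟪a, B⟫ a`
(apply the previous lemma to `w = B - ⟪a, B⟫ a ⊥ a`: `‖w‖² = ⟪w, B⟫ = 0`). [folklore] -/
theorem landauTail_eq_inner_smul_of_map_eq {a B : EuclideanSpace ℝ (Fin 3)} (ha : ‖a‖ = 1)
    (h : ∀ S : EuclideanSpace ℝ (Fin 3) ≃ₗᵢ[ℝ] EuclideanSpace ℝ (Fin 3), S a = a → S B = B) :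
    B = ⟪a, B⟫ • a := by
  have hwa : ⟪B - ⟪a, B⟫ • a, a⟫ = 0 := by
    rw [inner_sub_left, real_inner_smul_left, real_inner_self_eq_norm_sq, ha, one_pow, mul_one,
      real_inner_comm, sub_self]
  have h1 := landauTail_inner_eq_zero_of_map_eq h hwa
  have h2 : ⟪B - ⟪a, B⟫ • a, B⟫ - ⟪B - ⟪a, B⟫ • a, B - ⟪a, B⟫ • a⟫ = 0 := by
    rw [← inner_sub_right, sub_sub_cancel, real_inner_smul_right, hwa, mul_zero]
  rw [h1, zero_sub, neg_eq_zero, inner_self_eq_zero, sub_eq_zero] at h2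
  exact h2

/-- A vector-valued integral over `ℝ³` whose integrand is covariant under a linear isometry `S`
(`I (S z) = S (I z)`) is fixed by `S`: `S ∫ I = ∫ S ∘ I = ∫ I ∘ S = ∫ I` (linearity of the
Bochner integral and invariance of Lebesgue measure). [folklore] -/
theorem landauTail_map_integral_of_comm
    (S : EuclideanSpace ℝ (Fin 3) ≃ₗᵢ[ℝ] EuclideanSpace ℝ (Fin 3))
    {I : EuclideanSpace ℝ (Fin 3) → EuclideanSpace ℝ (Fin 3)} (h : ∀ z, I (S z) = S (I z)) :
    S (∫ z, I z) = ∫ z, I z := by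
  calc S (∫ z, I z) = ∫ z, S (I z) := by
        simpa only [LinearIsometryEquiv.coe_toLinearIsometry] using
          (S.toLinearIsometry.integral_comp_comm I).symm
    _ = ∫ z, I (S z) := by simp only [h]
    _ = ∫ z, I z := S.measurePreserving.integral_comp S.toHomeomorph.measurableEmbedding I

/-! ### Covariance of the Landau flux integrand -/

/-- The flux integrand `I = ⟪U, ∇Ψ₁⟫ U + P ∇Ψ₁ + (ΔΨ₁) U` of the Landau solution with axis `a`
is covariant under every linear isometry `S` fixing `a`: `I (S z) = S (I z)`
(`U (S z) = S (U z)`, `P (S z) = P z`, `∇Ψ₁ z = 2G'(‖z‖²) z`, `ΔΨ₁` radial). [folklore] -/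
theorem landauTail_landau_fluxIntegrand_map (a : EuclideanSpace ℝ (Fin 3)) (A : ℝ)
    (S : EuclideanSpace ℝ (Fin 3) ≃ₗᵢ[ℝ] EuclideanSpace ℝ (Fin 3)) (hS : S a = a)
    (z : EuclideanSpace ℝ (Fin 3)) :
    ⟪landauAxisField a A (S z), gradient
          (fun y : EuclideanSpace ℝ (Fin 3) => Real.smoothTransition (‖y‖ ^ 2 - 1)) (S z)⟫ •
          landauAxisField a A (S z) +
        landauAxisPressure a A (S z) • gradient
          (fun y : EuclideanSpace ℝ (Fin 3) => Real.smoothTransition (‖y‖ ^ 2 - 1)) (S z) +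
      (Δ fun y : EuclideanSpace ℝ (Fin 3) => Real.smoothTransition (‖y‖ ^ 2 - 1)) (S z) •
        landauAxisField a A (S z) =
    S (⟪landauAxisField a A z, gradient
          (fun y : EuclideanSpace ℝ (Fin 3) => Real.smoothTransition (‖y‖ ^ 2 - 1)) z⟫ •
          landauAxisField a A z +
        landauAxisPressure a A z • gradient
          (fun y : EuclideanSpace ℝ (Fin 3) => Real.smoothTransition (‖y‖ ^ 2 - 1)) z +
      (Δ fun y : EuclideanSpace ℝ (Fin 3) => Real.smoothTransition (‖y‖ ^ 2 - 1)) z •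
        landauAxisField a A z) := by
  set G : ℝ → ℝ := fun ρ : ℝ => Real.smoothTransition (ρ - 1) with hG
  obtain ⟨hd₁, hd₂, -, -⟩ := landauTail_cutoffProfile_smooth hG
  have hgrad : ∀ x : EuclideanSpace ℝ (Fin 3),
      gradient (fun y => Real.smoothTransition (‖y‖ ^ 2 - 1)) x = (2 * deriv G (‖x‖ ^ 2)) • x :=
    fun x => (landauTail_gradient_laplacian_radial hd₁ hd₂ x).1
  have hlap : ∀ x : EuclideanSpace ℝ (Fin 3),
      (Δ fun y : EuclideanSpace ℝ (Fin 3) => Real.smoothTransition (‖y‖ ^ 2 - 1)) x =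
        4 * deriv (deriv G) (‖x‖ ^ 2) * ‖x‖ ^ 2 + 6 * deriv G (‖x‖ ^ 2) := fun x =>
    (landauTail_gradient_laplacian_radial hd₁ hd₂ x).2
  have hU : landauAxisField a A (S z) = S (landauAxisField a A z) := by
    have h := landauAxisField_map_linearIsometryEquiv S a A z
    rwa [hS] at h
  have hP : landauAxisPressure a A (S z) = landauAxisPressure a A z := by
    have h := landauAxisPressure_map_linearIsometryEquiv S a A z
    rwa [hS] at h
  rw [hU, hP, hgrad, hgrad, hlap, hlap, LinearIsometryEquiv.norm_map]
  simp only [map_add, LinearIsometryEquiv.map_smul, real_inner_smul_right,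
    LinearIsometryEquiv.inner_map_map]

/-! ### The two stubs -/

/-- **The Landau flux is parallel to the axis**: for the Landau solution `U = landauAxisField a A`,
`P = landauAxisPressure a A` (`‖a‖ = 1`, `A > 1`) and `Ψ₁(y) = smoothTransition (‖y‖² - 1)`,
`∫ (⟪U, ∇Ψ₁⟫ U + P ∇Ψ₁ + (ΔΨ₁) U) = (2π ∫_{-1}^{1} F_A) • a`: the integral is fixed by every
linear isometry fixing `a` (covariance of the integrand), hence is a multiple of `a`, and its
`a`-component is `landauTail_landau_flux_eq` (Landau 1944; Batchelor 1967, §4.6;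
Lemarié-Rieusset 2016, (10.48)). [folklore] -/
theorem landauTail_landau_flux_parallel : ∀ (a : EuclideanSpace ℝ (Fin 3)) (A : ℝ), ‖a‖ = 1 → 1 < A → (∫ z, (inner ℝ (Literature.Analysis.FluidPDE.landauAxisField a A z) (gradient (fun y : EuclideanSpace ℝ (Fin 3) => Real.smoothTransition (‖y‖ ^ 2 - 1)) z) • Literature.Analysis.FluidPDE.landauAxisField a A z + Literature.Analysis.FluidPDE.landauAxisPressure a A z • gradient (fun y : EuclideanSpace ℝ (Fin 3) => Real.smoothTransition (‖y‖ ^ 2 - 1)) z + Laplacian.laplacian (fun y : EuclideanSpace ℝ (Fin 3) => Real.smoothTransition (‖y‖ ^ 2 - 1)) z • Literature.Analysis.FluidPDE.landauAxisField a A z)) = (2 * Real.pi * ∫ c in (-1 : ℝ)..1, ((c * (2 * ((A ^ 2 - 1) / (A - c) ^ 2 - 1)) + 2 * (1 - c ^ 2) / (A - c)) * (2 * ((A ^ 2 - 1) / (A - c) ^ 2 - 1) + 1) + c * (4 * (A * c - 1) / (A - c) ^ 2))) • a := by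
  intro a A ha hA
  rw [← landauTail_landau_flux_eq a A ha hA]
  exact landauTail_eq_inner_smul_of_map_eq ha fun S hS =>
    landauTail_map_integral_of_comm S fun z => landauTail_landau_fluxIntegrand_map a A S hS z

/-- **Landau's point force** (solenoidal-tested form): for the Landau solution
`U = landauAxisField a A` (`‖a‖ = 1`, `A > 1`, viscosity `1`) and every smooth compactly
supported divergence-free `φ`,
`∫ ⟪U, (U·∇)φ⟫ + ⟪U, Δφ⟫ = -β(A) ⟪a, φ 0⟫`,
`β(A) = 2π [(8A/3)(3A² + 1)/(A² - 1) - 4A² log ((A + 1)/(A - 1))]`, i.e.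
`-ΔU + div (U ⊗ U) + ∇P = β(A) a δ₀` on solenoidal test fields (Landau 1944; Batchelor 1967,
§4.6; Šverák, arXiv:math/0604550, §2 (2.3); Lemarié-Rieusset 2016, (10.48)): the flux identity
`landauTail_flux_identity` for `(U, P)`, the direction `landauTail_landau_flux_parallel` and the
closed form `landauTail_landau_flux_integral` of the flux. [folklore] -/
theorem landauTail_landau_point_force : ∀ (a : EuclideanSpace ℝ (Fin 3)) (A : ℝ) (φ : EuclideanSpace ℝ (Fin 3) → EuclideanSpace ℝ (Fin 3)), ‖a‖ = 1 → 1 < A → ContDiff ℝ (⊤ : ℕ∞) φ → HasCompactSupport φ → (∀ x, Literature.Analysis.FluidPDE.VectorCalculus.divergence φ x = 0) → ∫ x, (inner ℝ (Literature.Analysis.FluidPDE.landauAxisField a A x) (Literature.Analysis.FluidPDE.convect (Literature.Analysis.FluidPDE.landauAxisField a A) φ x) + inner ℝ (Literature.Analysis.FluidPDE.landauAxisField a A x) (Laplacian.laplacian φ x)) = -((2 * Real.pi * (8 * A / 3 * (3 * A ^ 2 + 1) / (A ^ 2 - 1) - 4 * A ^ 2 * Real.log ((A + 1) / (A - 1))))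 * inner ℝ a (φ 0)) := by
  intro a A φ ha hA hφ hφc hφdiv
  obtain ⟨hU, hP, hns, hdiv, hhom, -⟩ := landauTail_landauAxisField_profile ha hA
  rw [landauTail_flux_identity _ _ φ hU hP hns hdiv hhom
      (fun c hc x => landauAxisPressure_smul a A hc x) hφ hφc hφdiv,
    landauTail_landau_flux_parallel a A ha hA, landauTail_landau_flux_integral A hA,
    real_inner_smul_right, real_inner_comm a (φ 0)]

end Summit.NavierStokesRegularity.NavierStokesRegularity.Theorems
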